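import Literature.NumberTheory.Sieve.BombieriFriedlanderIwaniecProofs
import Literature.NumberTheory.LFunctions.PrimeNumberTheoremErrorTermProofs
import HarnessLib

/-!
# BFI Theorem 10 in the `π`-form (Maynard's restatement) from the printed `ψ`-form

Topic `Literature/NumberTheory/Sieve`, second proofs companion of
`Literature.NumberTheory.Sieve.BombieriFriedlanderIwaniec`.  That file vendors Bombieri–Friedlander–Iwaniec,
Acta Math. 156 (1986), Theorem 10 twice: AS PRINTED (the `ψ`-form
`Literature.NumberTheory.Sieve.BombieriFriedlanderIwaniecTheorem10`:
`∑_{(q,a)=1} λ(q)(ψ(x;q,a) − x/φ(q)) ≪_{ε,a,A} x ℒ^{−A}` for `λ` well factorable of level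
`Q = x^{4/7−ε}`), and as RESTATED in Maynard, arXiv:2006.07088 (Mem. AMS 2025), p. 3, "Theorem
(Bombieri, Friedlander, Iwaniec)" (the `π`-form
`Literature.NumberTheory.Sieve.BombieriFriedlanderIwaniecTheorem10Pi`:
`∑_{q ≤ Q, (q,a)=1} λ_q (π(x;q,a) − π(x)/φ(q)) ≪_{a,A,ε} x/(log x)^A` for `λ` well factorable of
level `Q ≤ x^{4/7−ε}`).  Maynard states the `π`-form without proof, citing [BFI1] = the Acta paper,
whose Theorem 10 is the `ψ`-form; the passage between the two is the standard partial summation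
(Iwaniec–Kowalski, *Analytic Number Theory*, §17.1).  The companion
`Literature.NumberTheory.Sieve.BombieriFriedlanderIwaniecProofs` proves the direction `π`-form ⇒ `ψ`-form
(`bfi_wellFactorable_level_of_theorem10Pi`); the present file proves the direction needed to DERIVE
Maynard's restatement from the printed theorem:

* `Literature.NumberTheory.Sieve.BombieriFriedlanderIwaniecTheorem10Pi_of_theorem10_of_theta :
    BombieriFriedlanderIwaniecTheorem10 → ChebyshevThetaDeLaValleePoussin →
      BombieriFriedlanderIwaniecTheorem10Pi`;
* `Literature.NumberTheory.Sieve.BombieriFriedlanderIwaniecTheorem10Pi_of_theorem10 :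
    BombieriFriedlanderIwaniecTheorem10 → BombieriFriedlanderIwaniecTheorem10Pi`, feeding in the
  tree's PROOF of the prime number theorem with the de la Vallée Poussin error term
  (`Literature.NumberTheory.LFunctions.ChebyshevThetaDeLaValleePoussin_holds`,
  `PrimeNumberTheoremErrorTermProofs`);
* conversely `Literature.NumberTheory.Sieve.BombieriFriedlanderIwaniecTheorem10_of_theorem10Pi_of_theta :
    BombieriFriedlanderIwaniecTheorem10Pi → ChebyshevThetaDeLaValleePoussin →
      BombieriFriedlanderIwaniecTheorem10` (the printed form, UNIFORM in `λ`; the companion's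
  `bfi_wellFactorable_level_of_theorem10Pi` concludes only the family form), whence
* `Literature.NumberTheory.Sieve.BombieriFriedlanderIwaniecTheorem10Pi_iff_theorem10 :
    BombieriFriedlanderIwaniecTheorem10Pi ↔ BombieriFriedlanderIwaniecTheorem10`.

So the named fact `BombieriFriedlanderIwaniecTheorem10Pi` is EQUIVALENT to the theorem as printed,
`BombieriFriedlanderIwaniecTheorem10`, and rests on exactly the same printed deep theorems (which
`…Assembly` reduces to Theorems 0 (b), 1, 2, 5*, Lemma 3 of the source, Shiu's theorem, and
classical inputs).

## The argument (`namespace Literature.NumberTheory.Sieve.BFIReduction`)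

Fix `x ≥ 2`, moduli `q ≤ Qn`, `(q, a) = 1`, weights `|λ| ≤ 1`.  Abel summation from `ϑ(·; q, a)`
back to `π(·; q, a)` (`piMod_eq_thetaMod_div_log_add_integral`, the residue-class version of
Mathlib's `Chebyshev.primeCounting_eq_theta_div_log_add_integral`) gives the exact identity
(`bfiSum_eq_thetaSum`)

`B(x) = S_ϑ(x)/log x + ∫_2^x S_ϑ(t) dt/(t log² t)`,

where `B(t) = ∑_q λ(q)(π(t;q,a) − π(t)/φ(q))` (`bfiSum`) and
`S_ϑ(t) = ∑_q λ(q)(ϑ(t;q,a) − ϑ(t)/φ(q))` (written out in full below), and (`thetaSum_eq`)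

`S_ϑ(t) = ∑_q λ(q)(ψ(t;q,a) − t/φ(q)) − ∑_q λ(q) PP_q(t) − (ϑ(t) − t) ∑_q λ(q)/φ(q)`

(`PP_q(t) = chebyshevPsiModNotPrime q a ⌊t⌋`, the proper prime powers `≡ a (mod q)` up to `t`).
Take `Qn = ⌊Q⌋`, `1 ≤ Q ≤ x^{4/7−ε}`, `λ` well-factorable of level `Q`, `t₁ = x^{1−ε/2}`.
* For `t ∈ [t₁, x]`: `λ` is well-factorable of level `t^{4/7−ε/2} ≥ x^{4/7−ε} ≥ Q`
  (`IsWellFactorable.mono`, `rpow_level_le_rpow`) and vanishes above `Q`, so the printed Theorem 10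
  with `(ε/2, A+1)` gives `|∑_q λ(q)(ψ(t;q,a) − t/φ(q))| ≤ C₁ t/(log t)^{A+1} ≪ x/(log x)^{A+1}`; the
  prime powers give at most `∑_{q ≤ Qn} max_b PP_{q,b}(⌊x⌋) ≤ x/(log x)^{A+1}` (monotonicity in `t`
  and the tree's `eventually_sum_iSup_chebyshevPsiModNotPrime_le`, as `Qn ≤ x^{4/7} = x^{1−3/7}`); and
  `|ϑ(t) − t| ∑_{q ≤ Qn} 1/φ(q) ≤ C₂ t (log t)^{−A−3} (1 + log Qn)² ≪ x/(log x)^{A+1}`.  Hence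
  `|S_ϑ(t)| ≤ R = K₁ x/(log x)^{A+1}` on `[t₁, x]`, contributing `R/log x + R/log t₁ ≤ 3R/log x`
  (`∫_{t₁}^x dt/(t log² t) = 1/log t₁ − 1/log x`, Mathlib `integral_inv_div_log_sq`).
* For `t ∈ [2, t₁]` the trivial bound `|S_ϑ(t)| ≤ log t (t(1 + log Qn) + Qn) + (log 4) t (1 + log Qn)²`
  (`abs_thetaSum_le_trivial`) gives `∫_2^{t₁} |S_ϑ(t)| dt/(t log² t) ≤ 5(1 + log Qn)² t₁ + 2 Qn log t₁`
  (`abs_integral_thetaSum_le_small`), which is `≪ x/(log x)^A` (`exists_log_rpow_mul_rpow_le`).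
For `Q < 1` the weight vanishes identically; for `4/7 − ε < 0` the moduli range is empty.

## References

* E. Bombieri, J. B. Friedlander, H. Iwaniec, *Primes in arithmetic progressions to large moduli*,
  Acta Math. 156 (1986), 203–251, §1 Theorem 10 (p. 209). [BombieriFriedlanderIwaniecActa1986]
* J. Maynard, *Primes in arithmetic progressions to large moduli II: Well-factorable estimates*,
  arXiv:2006.07088 (Mem. AMS 2025), p. 3, Theorem (Bombieri, Friedlander, Iwaniec).
  [Maynard2020LargeModuliII]
* H. Iwaniec, E. Kowalski, *Analytic Number Theory*, AMS Colloq. Publ. 53 (2004), §17.1.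
* H. L. Montgomery, R. C. Vaughan, *Multiplicative Number Theory I*, CUP 2007, Theorem 6.9 (6.13).
-/

open Filter Asymptotics Finset Real MeasureTheory

namespace Literature.NumberTheory.Sieve

namespace BFIReduction

/-! ### `ϑ(t; q, a)`: monotonicity and the trivial bound -/

/-- `t ↦ ϑ(t; q, a)` is monotone. [folklore] -/
theorem thetaMod_mono (q : ℕ) (a : ZMod q) : Monotone (thetaMod q a) := by
  intro s t hst
  exact Finset.sum_le_sum_of_subset_of_nonneg
    (Finset.Icc_subset_Icc le_rfl (Nat.floor_le_floor hst))
    fun n _ _ => mul_nonneg (Real.log_natCast_nonneg n) (primeInd_nonneg q a n)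

/-- `0 ≤ ϑ(t; q, a)`. [folklore] -/
theorem thetaMod_nonneg (q : ℕ) (a : ZMod q) (t : ℝ) : 0 ≤ thetaMod q a t :=
  Finset.sum_nonneg fun n _ => mul_nonneg (Real.log_natCast_nonneg n) (primeInd_nonneg q a n)

/-- Trivial bound: `ϑ(t; q, a) ≤ log t · π(t; q, a) ≤ log t · (t/q + 1)` for `t ≥ 1` (and `q ≥ 1`;
for `q = 0` Lean's `t/0 = 0` and the residue condition `n = a` in `ZMod 0 = ℤ` leaves at most one
prime). [folklore] -/
theorem thetaMod_le (q : ℕ) (a : ZMod q) {t : ℝ} (ht : 1 ≤ t) :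
    thetaMod q a t ≤ Real.log t * (t / q + 1) := by
  have ht0 : 0 ≤ t := by linarith
  have hlt : 0 ≤ Real.log t := Real.log_nonneg ht
  calc thetaMod q a t ≤ ∑ n ∈ Icc 0 ⌊t⌋₊, Real.log t * primeInd q a n := by
        refine Finset.sum_le_sum fun n hn => ?_
        refine mul_le_mul_of_nonneg_right ?_ (primeInd_nonneg q a n)
        rcases Nat.eq_zero_or_pos n with rfl | hn0
        · simp only [Nat.cast_zero, Real.log_zero]
          exact hlt
        · have hnt : (n : ℝ) ≤ t := (Nat.le_floor_iff ht0).mp (Finset.mem_Icc.mp hn).2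
          exact Real.log_le_log (by exact_mod_cast hn0) hnt
    _ = Real.log t * piMod q a t := by rw [piMod, Finset.mul_sum]
    _ ≤ Real.log t * (t / q + 1) := mul_le_mul_of_nonneg_left (piMod_le q a ht0) hlt

/-! ### Abel summation from `ϑ(x; q, a)` back to `π(x; q, a)` -/

/-- **Abel summation for `π(x; q, a)`**: for `x ≥ 2`,
`π(x; q, a) = ϑ(x; q, a)/log x + ∫_2^x ϑ(t; q, a) dt/(t log² t)` (as Mathlib's
`Chebyshev.primeCounting_eq_theta_div_log_add_integral`, with the residue condition inserted).
[folklore] -/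
theorem piMod_eq_thetaMod_div_log_add_integral (q : ℕ) (a : ZMod q) {x : ℝ} (hx : 2 ≤ x) :
    piMod q a x = thetaMod q a x / Real.log x +
      ∫ t in (2 : ℝ)..x, thetaMod q a t * (t⁻¹ / Real.log t ^ 2) := by
  -- `π(x; q, a) = ∑ (log n)⁻¹ · (log n · 1_{P,a,q}(n))`
  set c : ℕ → ℝ := fun n => Real.log n * primeInd q a n with hc
  have hc0 : c 0 = 0 := by simp [hc]
  have hc1 : c 1 = 0 := by simp [hc]
  have hpi : piMod q a x = ∑ n ∈ Icc 0 ⌊x⌋₊, (fun t : ℝ => (Real.log t)⁻¹) n * c n := by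
    rw [piMod]
    refine Finset.sum_congr rfl fun n _ => ?_
    simp only [hc]
    by_cases hp : n.Prime
    · have hlog : Real.log n ≠ 0 :=
        Real.log_ne_zero_of_pos_of_ne_one (by exact_mod_cast hp.pos) (by exact_mod_cast hp.ne_one)
      rw [← mul_assoc, inv_mul_cancel₀ hlog, one_mul]
    · have : primeInd q a n = 0 := by simp [primeInd, hp]
      rw [this, mul_zero, mul_zero]
  have htheta : ∀ t : ℝ, ∑ k ∈ Icc 0 ⌊t⌋₊, c k = thetaMod q a t := fun t => rfl
  rw [hpi, sum_mul_eq_sub_integral_mul₁ c (f := fun t : ℝ => (Real.log t)⁻¹) hc0 hc1 x ?hdiff ?hint,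
    ← intervalIntegral.integral_of_le hx]
  case hdiff =>
    intro z ⟨hz1, _⟩
    have : z ≠ 0 := by linarith
    have : Real.log z ≠ 0 := by apply Real.log_ne_zero_of_pos_of_ne_one <;> linarith
    fun_prop
  case hint =>
    refine ContinuousOn.integrableOn_Icc fun z ⟨hz1, _⟩ => ContinuousWithinAt.congr ?_
      (fun _ _ => Real.deriv_inv_log_apply) Real.deriv_inv_log_apply
    have : z ≠ 0 := by linarith
    have : Real.log z ^ 2 ≠ 0 := by
      refine pow_ne_zero 2 <| Real.log_ne_zero_of_pos_of_ne_one ?_ ?_ <;> linarith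
    exact ContinuousAt.continuousWithinAt <| by fun_prop
  simp only [htheta, Real.deriv_inv_log]
  have hI : ∫ t in (2 : ℝ)..x, -t⁻¹ / Real.log t ^ 2 * thetaMod q a t =
      -∫ t in (2 : ℝ)..x, thetaMod q a t * (t⁻¹ / Real.log t ^ 2) := by
    rw [← intervalIntegral.integral_neg]
    exact intervalIntegral.integral_congr fun t _ => by ring
  rw [hI]
  ring

/-- `t ↦ t⁻¹/(log t)²` is continuous on `[b, c] ⊆ (1, ∞)`. [folklore] -/
theorem continuousOn_inv_div_log_sq {b c : ℝ} (hb : 1 < b) (hc : 1 < c) :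
    ContinuousOn (fun t : ℝ => t⁻¹ / Real.log t ^ 2) (Set.uIcc b c) := by
  refine fun t ht => ContinuousAt.continuousWithinAt ?_
  rw [Set.mem_uIcc] at ht
  have ht1 : 1 < t := by rcases ht with h | h <;> linarith [h.1]
  have : t ≠ 0 := by linarith
  have : Real.log t ^ 2 ≠ 0 := pow_ne_zero 2 (Real.log_pos ht1).ne'
  fun_prop

/-- `t ↦ (ϑ(t; q, a) − ϑ(t)/c) t⁻¹/(log t)²` is interval integrable on `[b, d] ⊆ (1, ∞)` (step
functions against a continuous weight). [folklore] -/
theorem intervalIntegrable_thetaDisc_mul (q : ℕ) (a : ZMod q) (c : ℝ) {b d : ℝ} (hb : 1 < b)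
    (hd : 1 < d) :
    IntervalIntegrable
      (fun t : ℝ => (thetaMod q a t - Chebyshev.theta t / c) * (t⁻¹ / Real.log t ^ 2)) volume b d :=
  ((thetaMod_mono q a).intervalIntegrable.sub
    (Chebyshev.theta_mono.intervalIntegrable.div_const c)).mul_continuousOn
    (continuousOn_inv_div_log_sq hb hd)

/-- **Per-modulus identity** (`x ≥ 2`):
`π(x; q, a) − π(x)/φ(q) = (ϑ(x; q, a) − ϑ(x)/φ(q))/log x`
  `+ ∫_2^x (ϑ(t; q, a) − ϑ(t)/φ(q)) dt/(t log² t)`,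
by Abel summation for `π(x; q, a)` and for `π(x)` (Mathlib). [folklore] -/
theorem piMod_sub_div_eq (q : ℕ) (a : ZMod q) {x : ℝ} (hx : 2 ≤ x) :
    piMod q a x - (Nat.primeCounting ⌊x⌋₊ : ℝ) / q.totient =
      (thetaMod q a x - Chebyshev.theta x / q.totient) / Real.log x +
      ∫ t in (2 : ℝ)..x,
        (thetaMod q a t - Chebyshev.theta t / q.totient) * (t⁻¹ / Real.log t ^ 2) := by
  have hx1 : 1 < x := by linarith
  have hπ : (Nat.primeCounting ⌊x⌋₊ : ℝ) = Chebyshev.theta x / Real.log x +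
      ∫ t in (2 : ℝ)..x, Chebyshev.theta t * (t⁻¹ / Real.log t ^ 2) := by
    rw [Chebyshev.primeCounting_eq_theta_div_log_add_integral hx]
    congr 1
    exact intervalIntegral.integral_congr fun t _ => by ring
  have hI : ∫ t in (2 : ℝ)..x,
      (thetaMod q a t - Chebyshev.theta t / q.totient) * (t⁻¹ / Real.log t ^ 2) =
      (∫ t in (2 : ℝ)..x, thetaMod q a t * (t⁻¹ / Real.log t ^ 2)) -
        (∫ t in (2 : ℝ)..x, Chebyshev.theta t * (t⁻¹ / Real.log t ^ 2)) / q.totient := by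
    rw [← intervalIntegral.integral_div, ← intervalIntegral.integral_sub
      ((thetaMod_mono q a).intervalIntegrable.mul_continuousOn
        (continuousOn_inv_div_log_sq one_lt_two hx1))
      ((Chebyshev.theta_mono.intervalIntegrable.mul_continuousOn
        (continuousOn_inv_div_log_sq one_lt_two hx1)).div_const _)]
    exact intervalIntegral.integral_congr fun t _ => by ring
  rw [piMod_eq_thetaMod_div_log_add_integral q a hx, hπ, hI]
  ring

/-! ### The weighted `ϑ`-sum and the summed identity -/

/-! Below, the weighted `ϑ`-discrepancy at height `t` is written out as
`S_ϑ(t) = ∑_{q ∈ moduli Qn a} λ(q) (ϑ(t; q, a) − ϑ(t)/φ(q))` (no auxiliary definition). -/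

/-- `t ↦ S_ϑ(t) t⁻¹/(log t)²` is interval integrable on `[b, d] ⊆ (1, ∞)`. [folklore] -/
theorem intervalIntegrable_thetaSum_mul (Qn : ℕ) (a : ℤ) (lam : ℕ → ℝ) {b d : ℝ} (hb : 1 < b)
    (hd : 1 < d) :
    IntervalIntegrable (fun t : ℝ =>
      (∑ q ∈ moduli Qn a, lam q * (thetaMod q (a : ZMod q) t - Chebyshev.theta t / q.totient)) *
        (t⁻¹ / Real.log t ^ 2)) volume b d := by
  have h : (fun t : ℝ =>
      (∑ q ∈ moduli Qn a, lam q * (thetaMod q (a : ZMod q) t - Chebyshev.theta t / q.totient)) *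
        (t⁻¹ / Real.log t ^ 2)) =
      ∑ q ∈ moduli Qn a, fun t : ℝ => lam q *
        ((thetaMod q (a : ZMod q) t - Chebyshev.theta t / q.totient) * (t⁻¹ / Real.log t ^ 2)) := by
    ext t
    rw [Finset.sum_apply, Finset.sum_mul]
    exact Finset.sum_congr rfl fun q _ => by ring
  rw [h]
  exact IntervalIntegrable.sum _ fun q _ =>
    (intervalIntegrable_thetaDisc_mul q _ _ hb hd).const_mul (lam q)

/-- **The summed identity** (`x ≥ 2`): `B(x) = S_ϑ(x)/log x + ∫_2^x S_ϑ(t) dt/(t log² t)`.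
[folklore] -/
theorem bfiSum_eq_thetaSum (Qn : ℕ) (a : ℤ) (lam : ℕ → ℝ) {x : ℝ} (hx : 2 ≤ x) :
    bfiSum Qn a lam x =
      (∑ q ∈ moduli Qn a, lam q * (thetaMod q (a : ZMod q) x - Chebyshev.theta x / q.totient)) /
          Real.log x +
        ∫ t in (2 : ℝ)..x,
          (∑ q ∈ moduli Qn a, lam q * (thetaMod q (a : ZMod q) t - Chebyshev.theta t / q.totient)) *
            (t⁻¹ / Real.log t ^ 2) := by
  have hx1 : 1 < x := by linarith
  have h1 : ∀ q ∈ moduli Qn a,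
      lam q * (piMod q (a : ZMod q) x - (Nat.primeCounting ⌊x⌋₊ : ℝ) / q.totient) =
      lam q * (thetaMod q (a : ZMod q) x - Chebyshev.theta x / q.totient) / Real.log x +
      ∫ t in (2 : ℝ)..x, lam q *
        ((thetaMod q (a : ZMod q) t - Chebyshev.theta t / q.totient) * (t⁻¹ / Real.log t ^ 2)) := by
    intro q _
    rw [piMod_sub_div_eq q _ hx, intervalIntegral.integral_const_mul]
    ring
  have h2 : ∑ q ∈ moduli Qn a, (∫ t in (2 : ℝ)..x, lam q *
      ((thetaMod q (a : ZMod q) t - Chebyshev.theta t / q.totient) * (t⁻¹ / Real.log t ^ 2))) =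
      ∫ t in (2 : ℝ)..x,
        (∑ q ∈ moduli Qn a, lam q * (thetaMod q (a : ZMod q) t - Chebyshev.theta t / q.totient)) *
          (t⁻¹ / Real.log t ^ 2) := by
    rw [← intervalIntegral.integral_finsetSum (μ := volume)
      (f := fun (q : ℕ) (t : ℝ) => lam q *
        ((thetaMod q (a : ZMod q) t - Chebyshev.theta t / q.totient) * (t⁻¹ / Real.log t ^ 2)))
      fun q _ => (intervalIntegrable_thetaDisc_mul q _ _ one_lt_two hx1).const_mul (lam q)]
    refine intervalIntegral.integral_congr fun t _ => ?_
    simp only [Finset.sum_mul]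
    exact Finset.sum_congr rfl fun q _ => by ring
  rw [bfiSum, Finset.sum_congr rfl h1, Finset.sum_add_distrib, h2, ← Finset.sum_div]

/-- **The three pieces of `S_ϑ(t)`**:
`S_ϑ(t) = ∑_q λ(q)(ψ(t; q, a) − t/φ(q)) − ∑_q λ(q) PP_q(t) − (ϑ(t) − t) ∑_q λ(q)/φ(q)`, where
`PP_q(t) = chebyshevPsiModNotPrime q a ⌊t⌋` collects the proper prime powers. [folklore] -/
theorem thetaSum_eq (Qn : ℕ) (a : ℤ) (lam : ℕ → ℝ) (t : ℝ) :
    (∑ q ∈ moduli Qn a, lam q * (thetaMod q (a : ZMod q) t - Chebyshev.theta t / q.totient)) =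
      (∑ q ∈ moduli Qn a, lam q * (LevelOfDistribution.chebyshevPsiMod q (a : ZMod q) t - t / q.totient))
      - (∑ q ∈ moduli Qn a, lam q * chebyshevPsiModNotPrime q (a : ZMod q) ⌊t⌋₊)
      - (Chebyshev.theta t - t) * ∑ q ∈ moduli Qn a, lam q / q.totient := by
  rw [Finset.mul_sum, ← Finset.sum_sub_distrib, ← Finset.sum_sub_distrib]
  refine Finset.sum_congr rfl fun q _ => ?_
  rw [chebyshevPsiMod_eq_thetaMod_add]
  ring

/-- **Trivial bound** for the weighted `ϑ`-sum: for `|λ| ≤ 1` and `t ≥ 1`,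
`|S_ϑ(t)| ≤ log t (t (1 + log Qn) + Qn) + (log 4) t (1 + log Qn)²`, from
`ϑ(t; q, a) ≤ log t (t/q + 1)`, Chebyshev's `ϑ(t) ≤ (log 4) t`, `∑_{q ≤ Qn} 1/q ≤ 1 + log Qn` and
`∑_{q ≤ Qn} 1/φ(q) ≤ (1 + log Qn)²`. [folklore] -/
theorem abs_thetaSum_le_trivial (Qn : ℕ) (a : ℤ) {lam : ℕ → ℝ} (hlam : ∀ q, |lam q| ≤ 1) {t : ℝ}
    (ht : 1 ≤ t) :
    |(∑ q ∈ moduli Qn a, lam q * (thetaMod q (a : ZMod q) t - Chebyshev.theta t / q.totient))| ≤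
      Real.log t * (t * (1 + Real.log Qn) + Qn) +
      Real.log 4 * t * (1 + Real.log Qn) ^ 2 := by
  have ht0 : 0 ≤ t := by linarith
  have hlt : 0 ≤ Real.log t := Real.log_nonneg ht
  have hlog4 : 0 ≤ Real.log 4 := Real.log_nonneg (by norm_num)
  have hθ0 : 0 ≤ Chebyshev.theta t := Chebyshev.theta_nonneg t
  have hθ : Chebyshev.theta t ≤ Real.log 4 * t := Chebyshev.theta_le_log4_mul_x ht0
  have hc1 : 0 ≤ Real.log t * t := mul_nonneg hlt ht0
  have hc2 : 0 ≤ Real.log 4 * t := mul_nonneg hlog4 ht0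
  have hsplit : ∀ q : ℕ, Real.log t * (t / q + 1) + Real.log 4 * t * ((q.totient : ℝ))⁻¹ =
      Real.log t * t * ((q : ℝ))⁻¹ + Real.log t + Real.log 4 * t * ((q.totient : ℝ))⁻¹ :=
    fun q => by ring
  calc |(∑ q ∈ moduli Qn a, lam q * (thetaMod q (a : ZMod q) t - Chebyshev.theta t / q.totient))|
      ≤ ∑ q ∈ moduli Qn a, |lam q * (thetaMod q (a : ZMod q) t - Chebyshev.theta t / q.totient)| :=
        Finset.abs_sum_le_sum_abs _ _
    _ ≤ ∑ q ∈ moduli Qn a, (Real.log t * (t / q + 1) + Real.log 4 * t * ((q.totient : ℝ))⁻¹) := by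
        refine Finset.sum_le_sum fun q hq => ?_
        have hq1 := one_le_of_mem_moduli hq
        have hφ : (0 : ℝ) < q.totient := by exact_mod_cast Nat.totient_pos.mpr hq1
        rw [abs_mul]
        refine (mul_le_of_le_one_left (abs_nonneg _) (hlam q)).trans ?_
        refine (abs_sub _ _).trans (add_le_add ?_ ?_)
        · rw [abs_of_nonneg (thetaMod_nonneg _ _ _)]
          exact thetaMod_le q _ ht
        · rw [abs_of_nonneg (div_nonneg hθ0 hφ.le), div_eq_mul_inv]
          exact mul_le_mul_of_nonneg_right hθ (inv_nonneg.mpr hφ.le)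
    _ ≤ ∑ q ∈ Icc 1 Qn, (Real.log t * (t / q + 1) + Real.log 4 * t * ((q.totient : ℝ))⁻¹) :=
        Finset.sum_le_sum_of_subset_of_nonneg (moduli_subset Qn a) fun q _ _ =>
          add_nonneg (mul_nonneg hlt (by positivity)) (mul_nonneg hc2 (by positivity))
    _ = Real.log t * t * ∑ q ∈ Icc 1 Qn, ((q : ℝ))⁻¹ + Qn * Real.log t +
          Real.log 4 * t * ∑ q ∈ Icc 1 Qn, ((q.totient : ℝ))⁻¹ := by
        simp_rw [hsplit]
        rw [Finset.sum_add_distrib, Finset.sum_add_distrib, ← Finset.mul_sum, ← Finset.mul_sum,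
          Finset.sum_const, nsmul_eq_mul, Nat.card_Icc, Nat.add_sub_cancel]
    _ ≤ Real.log t * t * (1 + Real.log Qn) + Qn * Real.log t +
          Real.log 4 * t * (1 + Real.log Qn) ^ 2 := by
        have h1 := Sieve.harmonic_Icc_le Qn
        have h2 : ∑ q ∈ Icc 1 Qn, ((q.totient : ℝ))⁻¹ ≤ (1 + Real.log Qn) ^ 2 :=
          Sieve.totientInvSum_le Qn
        gcongr
    _ = Real.log t * (t * (1 + Real.log Qn) + Qn) + Real.log 4 * t * (1 + Real.log Qn) ^ 2 := by
        ring

/-- Pointwise form of the trivial bound against the weight `1/(t log² t)` for `t ≥ 2`: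
`|S_ϑ(t)| t⁻¹ (log t)^{−2} ≤ 5 (1 + log Qn)² + (3/2) Qn/t` (using `log 2 > 2/3`, `log 4 < 7/5`).
[folklore] -/
theorem abs_thetaSum_mul_le (Qn : ℕ) (a : ℤ) {lam : ℕ → ℝ} (hlam : ∀ q, |lam q| ≤ 1) {t : ℝ}
    (ht : 2 ≤ t) :
    |(∑ q ∈ moduli Qn a, lam q * (thetaMod q (a : ZMod q) t - Chebyshev.theta t / q.totient)) *
        (t⁻¹ / Real.log t ^ 2)| ≤
      5 * (1 + Real.log Qn) ^ 2 + 3 / 2 * Qn * t⁻¹ := by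
  have ht0 : 0 < t := by linarith
  set ℓ : ℝ := Real.log t with hℓ
  set u : ℝ := 1 + Real.log Qn with hu
  have hℓ2 : 2 / 3 ≤ ℓ := by
    have h2 : Real.log 2 ≤ ℓ := Real.log_le_log two_pos ht
    linarith [Real.log_two_gt_d9]
  have hℓ0 : 0 < ℓ := by linarith
  have hu1 : 1 ≤ u := by
    have := Real.log_natCast_nonneg Qn
    rw [hu]; linarith
  have hQ0 : (0 : ℝ) ≤ Qn := Nat.cast_nonneg _
  have hlog4 : Real.log 4 ≤ 7 / 5 := by
    have h4 : Real.log 4 = 2 * Real.log 2 := by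
      rw [show (4 : ℝ) = 2 ^ 2 by norm_num, Real.log_pow]; norm_num
    rw [h4]; linarith [Real.log_two_lt_d9]
  have hw0 : 0 < t⁻¹ / ℓ ^ 2 := by positivity
  rw [abs_mul, abs_of_pos hw0]
  have hmain := abs_thetaSum_le_trivial Qn a hlam (by linarith : (1 : ℝ) ≤ t)
  rw [← hℓ, ← hu] at hmain
  -- `|S| ≤ ℓ (t u + Qn) + (log 4) t u²  ≤ (5 u² + (3/2) Qn/t) · t ℓ²`
  have hkey : ℓ * (t * u + Qn) + Real.log 4 * t * u ^ 2 ≤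
      (5 * u ^ 2 + 3 / 2 * Qn * t⁻¹) * (t * ℓ ^ 2) := by
    have e : (5 * u ^ 2 + 3 / 2 * Qn * t⁻¹) * (t * ℓ ^ 2) =
        5 * u ^ 2 * t * ℓ ^ 2 + 3 / 2 * Qn * ℓ ^ 2 := by
      field_simp
    rw [e]
    have p0 : ℓ ≤ 3 / 2 * ℓ ^ 2 := by nlinarith
    have p1 : ℓ * (t * u) ≤ 3 / 2 * ℓ ^ 2 * (t * u) :=
      mul_le_mul_of_nonneg_right p0 (by positivity)
    have p2 : ℓ * Qn ≤ 3 / 2 * ℓ ^ 2 * Qn := mul_le_mul_of_nonneg_right p0 hQ0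
    have p3' : Real.log 4 ≤ 63 / 20 * ℓ ^ 2 := by nlinarith
    have p3 : Real.log 4 * (t * u ^ 2) ≤ 63 / 20 * ℓ ^ 2 * (t * u ^ 2) :=
      mul_le_mul_of_nonneg_right p3' (by positivity)
    have p4 : u ≤ u ^ 2 := by nlinarith
    have p5 : 3 / 2 * ℓ ^ 2 * (t * u) + 63 / 20 * ℓ ^ 2 * (t * u ^ 2) ≤ 5 * u ^ 2 * t * ℓ ^ 2 := by
      have : 0 ≤ ℓ ^ 2 * t := by positivity
      nlinarith
    nlinarith
  calc |(∑ q ∈ moduli Qn a, lam q * (thetaMod q (a : ZMod q) t - Chebyshev.theta t / q.totient))| *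
        (t⁻¹ / ℓ ^ 2)
      ≤ (ℓ * (t * u + Qn) + Real.log 4 * t * u ^ 2) * (t⁻¹ / ℓ ^ 2) :=
        mul_le_mul_of_nonneg_right hmain hw0.le
    _ ≤ (5 * u ^ 2 + 3 / 2 * Qn * t⁻¹) * (t * ℓ ^ 2) * (t⁻¹ / ℓ ^ 2) :=
        mul_le_mul_of_nonneg_right hkey hw0.le
    _ = 5 * u ^ 2 + 3 / 2 * Qn * t⁻¹ := by
        field_simp

/-- **The integral over the initial range.** For `|λ| ≤ 1` and `2 ≤ t₁`,
`|∫_2^{t₁} S_ϑ(t) dt/(t log² t)| ≤ 5 (1 + log Qn)² t₁ + 2 Qn log t₁`. [folklore] -/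
theorem abs_integral_thetaSum_le_small (Qn : ℕ) (a : ℤ) {lam : ℕ → ℝ} (hlam : ∀ q, |lam q| ≤ 1)
    {t₁ : ℝ} (h2 : 2 ≤ t₁) :
    |∫ t in (2 : ℝ)..t₁,
        (∑ q ∈ moduli Qn a, lam q * (thetaMod q (a : ZMod q) t - Chebyshev.theta t / q.totient)) *
          (t⁻¹ / Real.log t ^ 2)| ≤
      5 * (1 + Real.log Qn) ^ 2 * t₁ + 2 * Qn * Real.log t₁ := by
  have ht0 : 0 < t₁ := by linarith
  set L := Real.log Qn with hL
  have hQ : (0 : ℝ) ≤ Qn := Nat.cast_nonneg _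
  have hg : IntervalIntegrable (fun t : ℝ => 5 * (1 + L) ^ 2 + 3 / 2 * Qn * t⁻¹) volume 2 t₁ :=
    intervalIntegrable_const.add
      (((continuousOn_inv_uIcc two_pos ht0).intervalIntegrable).const_mul _)
  have hbound : ∀ᵐ t ∂volume, t ∈ Set.Ioc 2 t₁ →
      ‖(∑ q ∈ moduli Qn a, lam q * (thetaMod q (a : ZMod q) t - Chebyshev.theta t / q.totient)) *
          (t⁻¹ / Real.log t ^ 2)‖ ≤
        5 * (1 + L) ^ 2 + 3 / 2 * Qn * t⁻¹ := by
    refine ae_of_all _ fun t ht => ?_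
    rw [Real.norm_eq_abs]
    exact abs_thetaSum_mul_le Qn a hlam ht.1.le
  have hle := intervalIntegral.norm_integral_le_of_norm_le h2 hbound hg
  rw [Real.norm_eq_abs] at hle
  refine hle.trans ?_
  rw [intervalIntegral.integral_add intervalIntegrable_const
      (((continuousOn_inv_uIcc two_pos ht0).intervalIntegrable).const_mul _),
    intervalIntegral.integral_const, intervalIntegral.integral_const_mul,
    integral_inv_of_pos two_pos ht0, smul_eq_mul]
  have hlog : Real.log (t₁ / 2) ≤ Real.log t₁ :=
    Real.log_le_log (by positivity) (by linarith)
  have hlog0 : 0 ≤ Real.log t₁ := Real.log_nonneg (by linarith)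
  nlinarith [mul_le_mul_of_nonneg_left hlog hQ, sq_nonneg (1 + L), mul_nonneg hQ hlog0]

/-- **The integral over the final range.** If `|S_ϑ(t)| ≤ R` on `[t₁, x]` (`2 ≤ t₁ ≤ x`), then
`|∫_{t₁}^x S_ϑ(t) dt/(t log² t)| ≤ R (1/log t₁ − 1/log x) ≤ R/log t₁`
(`∫ dt/(t log² t) = −1/log t`). [folklore] -/
theorem abs_integral_thetaSum_le_large (Qn : ℕ) (a : ℤ) (lam : ℕ → ℝ) {t₁ x R : ℝ}
    (h2 : 2 ≤ t₁) (ht₁x : t₁ ≤ x)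
    (hR : ∀ t, t₁ ≤ t → t ≤ x →
      |(∑ q ∈ moduli Qn a, lam q * (thetaMod q (a : ZMod q) t - Chebyshev.theta t / q.totient))| ≤ R) :
    |∫ t in t₁..x,
        (∑ q ∈ moduli Qn a, lam q * (thetaMod q (a : ZMod q) t - Chebyshev.theta t / q.totient)) *
          (t⁻¹ / Real.log t ^ 2)| ≤
      R / Real.log t₁ := by
  have ht1 : 1 < t₁ := by linarith
  have hx1 : 1 < x := by linarith
  have hR0 : 0 ≤ R := (abs_nonneg _).trans (hR t₁ le_rfl ht₁x)
  have hg : IntervalIntegrable (fun t : ℝ => R * (t⁻¹ / Real.log t ^ 2)) volume t₁ x :=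
    ((continuousOn_inv_div_log_sq ht1 hx1).intervalIntegrable).const_mul R
  have hbound : ∀ᵐ t ∂volume, t ∈ Set.Ioc t₁ x →
      ‖(∑ q ∈ moduli Qn a, lam q * (thetaMod q (a : ZMod q) t - Chebyshev.theta t / q.totient)) *
          (t⁻¹ / Real.log t ^ 2)‖ ≤
        R * (t⁻¹ / Real.log t ^ 2) := by
    refine ae_of_all _ fun t ht => ?_
    have ht0 : 0 < t := by linarith [ht.1]
    have hw : 0 ≤ t⁻¹ / Real.log t ^ 2 := by positivity
    rw [Real.norm_eq_abs, abs_mul, abs_of_nonneg hw]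
    exact mul_le_mul_of_nonneg_right (hR t ht.1.le ht.2) hw
  have hle := intervalIntegral.norm_integral_le_of_norm_le ht₁x hbound hg
  rw [Real.norm_eq_abs] at hle
  refine hle.trans ?_
  rw [intervalIntegral.integral_const_mul, integral_inv_div_log_sq ht1 hx1]
  have hlx : 0 ≤ (Real.log x)⁻¹ := inv_nonneg.mpr (Real.log_nonneg hx1.le)
  rw [div_eq_mul_inv]
  nlinarith [mul_nonneg hR0 hlx]

/-- BFI Theorem 10 (`ψ`-form, as printed) bounds the `ψ`-piece of `S_ϑ(t)` at every height
`t ∈ [x^{1−ε/2}, x]` for weights of level `Q`, `1 ≤ Q ≤ x^{4/7−ε}` (the level fits: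
`Q ≤ x^{4/7−ε} ≤ t^{4/7−ε/2}`, `rpow_level_le_rpow`, and `λ` vanishes above `Q`, so the printed
sum over `q ≤ t^{4/7−ε/2}` is the sum over `q ≤ Q`). [folklore] -/
theorem abs_psiSum_le_of_theorem10 {a : ℤ} {A ε η C₁ x₁ : ℝ} (hε : 0 < ε) (hγ : 0 ≤ 4 / 7 - ε)
    (hηdef : η = ε / 2)
    (H10 : ∀ t : ℝ, x₁ ≤ t → ∀ lam : ℕ → ℝ, IsWellFactorable (t ^ (4 / 7 - η)) lam →
      |∑ q ∈ (Icc 1 ⌊t ^ (4 / 7 - η)⌋₊).filter (fun q : ℕ => IsCoprime (q : ℤ) a),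
          lam q * (LevelOfDistribution.chebyshevPsiMod q (a : ZMod q) t - t / Nat.totient q)| ≤
        C₁ * t / Real.log t ^ (A + 1))
    {x Q t : ℝ} (hx : 1 ≤ x) (hQ1 : 1 ≤ Q) (hQ : Q ≤ x ^ (4 / 7 - ε)) {lam : ℕ → ℝ}
    (hlam : IsWellFactorable Q lam) (hx₁t : x₁ ≤ t) (ht : x ^ (1 - η) ≤ t) :
    |∑ q ∈ moduli ⌊Q⌋₊ a,
        lam q * (LevelOfDistribution.chebyshevPsiMod q (a : ZMod q) t - t / q.totient)| ≤
      C₁ * t / Real.log t ^ (A + 1) := by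
  subst hηdef
  have hlevel : Q ≤ t ^ (4 / 7 - ε / 2) := hQ.trans (rpow_level_le_rpow hε hγ hx ht)
  have hlam' : IsWellFactorable (t ^ (4 / 7 - ε / 2)) lam := hlam.mono hQ1 hlevel
  have h := H10 t hx₁t lam hlam'
  rwa [hlam.sum_Icc_eq_sum_Icc_floor (Nat.floor_le_floor hlevel)
    (fun q : ℕ => IsCoprime (q : ℤ) a)
    (fun q => LevelOfDistribution.chebyshevPsiMod q (a : ZMod q) t - t / Nat.totient q)] at h

end BFIReduction


open BFIReduction in
/-- **BFI Theorem 10, `π`-form (Maynard's restatement), from the printed `ψ`-form and the prime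
number theorem.**  `BombieriFriedlanderIwaniecTheorem10` (Acta Math. 156 (1986), §1, Theorem 10,
as printed: the `ψ`-form, uniform over well-factorable `λ` of level `x^{4/7−ε}`) together with
`ϑ(x) = x + O(x exp(−c√log x))` (`ChebyshevThetaDeLaValleePoussin`, Montgomery–Vaughan Thm 6.9
(6.13)) implies `BombieriFriedlanderIwaniecTheorem10Pi` (the `π`-form with expected value
`π(x)/φ(q)`, uniform over `Q ≤ x^{4/7−ε}` and well-factorable `λ` of level `Q`, as the theorem is
quoted in Maynard, arXiv:2006.07088, p. 3, and Lichtman, arXiv:2309.08522, (1.3)).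
Proof: the module docstring (Abel summation from `ϑ(·; q, a)` back to `π(·; q, a)`, the printed
theorem with `(ε/2, A+1)` on `[x^{1−ε/2}, x]`, trivial bounds below, the averaged prime-power bound
and the prime number theorem for the main terms); this is the standard equivalence of the `π`- and
`ψ`-forms (Iwaniec–Kowalski §17.1). [cite: IwaniecKowalski2004, §17.1] -/
theorem BombieriFriedlanderIwaniecTheorem10Pi_of_theorem10_of_theta
    (h10 : BombieriFriedlanderIwaniecTheorem10) (hθ : LFunctions.ChebyshevThetaDeLaValleePoussin) :
    BombieriFriedlanderIwaniecTheorem10Pi := by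
  intro a ha A hA ε hε
  set γ : ℝ := 4 / 7 - ε with hγ
  rcases lt_or_ge γ 0 with hγ0 | hγ0
  · -- degenerate case `4/7 − ε < 0`: for `x > 1` the moduli range `q ≤ Q ≤ x^γ < 1` is empty
    refine ⟨0, 2, fun x hx Q hQ _lam _hlam => ?_⟩
    have hx1 : (1 : ℝ) < x := by linarith
    have hQ1 : Q < 1 := hQ.trans_lt (Real.rpow_lt_one_of_one_lt_of_neg hx1 hγ0)
    have hfloor : ⌊Q⌋₊ = 0 := Nat.floor_eq_zero.mpr hQ1
    rw [hfloor]
    simp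
  -- main case `0 ≤ γ = 4/7 − ε`; put `η = ε/2 < 1`
  set η : ℝ := ε / 2 with hη
  have hη0 : 0 < η := by positivity
  have hη27 : η ≤ 2 / 7 := by rw [hη]; linarith only [hγ0, hγ]
  have hη1 : η < 1 := by linarith only [hη27]
  have h1η : 0 < 1 - η := by linarith only [hη27]
  -- the constants
  obtain ⟨C₁, x₁, hC₁, hx₁2, H10⟩ := h10.bound_nonneg ha hη0 (by linarith only [hA] : 0 < A + 1)
  obtain ⟨C₂, H2⟩ := hθ.logPow (A + 3)
  obtain ⟨D₁, hD₁, HD1⟩ := exists_log_rpow_mul_rpow_le hA.le (by norm_num : (0:ℝ) ≤ 2) hη0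
  obtain ⟨D₂, hD₂, HD2⟩ :=
    exists_log_rpow_mul_rpow_le hA.le (by norm_num : (0:ℝ) ≤ 1) (by norm_num : (0:ℝ) < 3 / 7)
  set C₂' : ℝ := max C₂ 0 with hC₂'
  have hC₂'0 : 0 ≤ C₂' := le_max_right _ _
  set K₁ : ℝ := C₁ / (1 - η) ^ (A + 1) + 1 + 4 * (C₂' / (1 - η) ^ (A + 3)) with hK₁
  have hK₁0 : 0 ≤ K₁ := by positivity
  set K : ℝ := 3 * K₁ + 20 * D₁ + 2 * D₂ with hK
  -- thresholds in `x`
  have hev₁ : ∀ᶠ x : ℝ in atTop, x₁ ≤ x ^ (1 - η) :=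
    (tendsto_rpow_atTop h1η).eventually_ge_atTop x₁
  obtain ⟨x₀, hx₀⟩ := Filter.eventually_atTop.mp (hev₁.and ((eventually_ge_atTop (Real.exp 1)).and
    (eventually_sum_iSup_chebyshevPsiModNotPrime_le (by norm_num : (0:ℝ) < 3 / 7) (A + 1))))
  refine ⟨K, x₀, fun x hx Q hQ lam hlam => ?_⟩
  obtain ⟨hx₁, hxe, hPP⟩ := hx₀ x hx
  -- basic facts about `x`
  have hx2 : (2 : ℝ) ≤ x := le_trans (by linarith only [Real.add_one_le_exp (1 : ℝ)]) hxe
  have hx1 : (1 : ℝ) < x := by linarith only [hx2]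
  have hx1' : (1 : ℝ) ≤ x := hx1.le
  have hx0 : (0 : ℝ) < x := by linarith only [hx2]
  rw [mul_div_assoc]
  set L : ℝ := Real.log x with hLdef
  have hL1 : 1 ≤ L := by
    rw [hLdef, ← Real.log_exp 1]; exact Real.log_le_log (Real.exp_pos 1) hxe
  have hL0 : 0 < L := by linarith only [hL1]
  have hLA : 0 < L ^ A := Real.rpow_pos_of_pos hL0 A
  set X : ℝ := x / L ^ A with hXdef
  have hX0 : 0 < X := div_pos hx0 hLA
  have hKX : 0 ≤ K * X := by positivity
  -- rewrite the goal through `bfiSum`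
  suffices key : |bfiSum ⌊Q⌋₊ a lam x| ≤ K * X by rwa [bfiSum_eq] at key
  -- the case `Q < 1`: the weight vanishes identically
  rcases lt_or_ge Q 1 with hQ1 | hQ1
  · have hlam0 : lam = fun _ => 0 := hlam.eq_zero_of_level_lt_one hQ1
    rw [hlam0, bfiSum]
    simpa using hKX
  -- the level and the moduli
  set Qn : ℕ := ⌊Q⌋₊ with hQn
  have hQ0 : 0 ≤ Q := zero_le_one.trans hQ1
  have hQnQ : (Qn : ℝ) ≤ Q := Nat.floor_le hQ0
  have hQnle : (Qn : ℝ) ≤ x ^ γ := hQnQ.trans hQ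
  have hγ47 : x ^ γ ≤ x ^ (4 / 7 : ℝ) :=
    Real.rpow_le_rpow_of_exponent_le hx1' (by rw [hγ]; linarith only [hε])
  have hγx : x ^ γ ≤ x := by
    refine (Real.rpow_le_rpow_of_exponent_le hx1'
      (show γ ≤ 1 by rw [hγ]; linarith only [hε])).trans ?_
    rw [Real.rpow_one]
  have hQnx : (Qn : ℝ) ≤ x := hQnle.trans hγx
  have hlogQn0 : 0 ≤ Real.log Qn := Real.log_natCast_nonneg Qn
  have hlogQn : Real.log Qn ≤ L := by
    rcases Nat.eq_zero_or_pos Qn with h0 | hpos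
    · rw [h0, Nat.cast_zero, Real.log_zero]; exact hL0.le
    · exact Real.log_le_log (by exact_mod_cast hpos) hQnx
  have hlogQn2 : (1 + Real.log Qn) ^ 2 ≤ 4 * L ^ 2 := by
    have h : 1 + Real.log Qn ≤ 2 * L := by linarith only [hlogQn, hL1]
    calc (1 + Real.log Qn) ^ 2 ≤ (2 * L) ^ 2 := pow_le_pow_left₀ (by linarith only [hlogQn0]) h 2
      _ = 4 * L ^ 2 := by ring
  -- the weights
  have hlam1 : ∀ q, |lam q| ≤ 1 := fun q => hlam.abs_le_one q
  -- `t₁ = x^{1-η}`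
  set t₁ : ℝ := x ^ (1 - η) with ht₁
  have ht₁2 : 2 ≤ t₁ := hx₁2.trans hx₁
  have ht₁x : t₁ ≤ x := by
    refine (Real.rpow_le_rpow_of_exponent_le hx1'
      (show 1 - η ≤ 1 by linarith only [hη0])).trans ?_
    rw [Real.rpow_one]
  have hlogt₁ : Real.log t₁ = (1 - η) * L := Real.log_rpow hx0 _
  have hlogt₁L : Real.log t₁ ≤ L := by
    rw [hlogt₁]; exact mul_le_of_le_one_left hL0.le (by linarith only [hη0])
  have hlogt₁0 : 0 < Real.log t₁ := Real.log_pos (by linarith only [ht₁2])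
  have hlogt₁ge : L / 2 ≤ Real.log t₁ := by rw [hlogt₁]; nlinarith only [hη27, hL0]
  -- power bookkeeping
  have hLA1 : L ^ (A + 1) = L ^ A * L := Real.rpow_add_one hL0.ne' A
  have hLA2 : L ^ (A + 2) = L ^ A * L ^ 2 := by
    rw [Real.rpow_add hL0, Real.rpow_two]
  have hLA3 : L ^ (A + 3) = L ^ (A + 1) * L ^ 2 := by
    rw [show A + 3 = (A + 1) + 2 by ring, Real.rpow_add hL0, Real.rpow_two]
  have hLA10 : 0 < L ^ (A + 1) := Real.rpow_pos_of_pos hL0 _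
  have HD1x : L ^ 2 * x ^ (1 - η) ≤ D₁ * X := by
    have := HD1 x hx1; rwa [Real.rpow_two] at this
  have HD2x : L * x ^ (4 / 7 : ℝ) ≤ D₂ * X := by
    have := HD2 x hx1; rwa [Real.rpow_one, show (1 : ℝ) - 3 / 7 = 4 / 7 by norm_num] at this
  -- `R = K₁ x/(log x)^{A+1}` bounds `S_ϑ(t)` on `[t₁, x]`
  set R : ℝ := K₁ * (x / L ^ (A + 1)) with hRdef
  have hR0 : 0 ≤ R := by positivity
  have hRX : R = K₁ * X / L := by
    rw [hRdef, hXdef, hLA1]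
    ring
  have hR : ∀ t, t₁ ≤ t → t ≤ x →
      |(∑ q ∈ moduli Qn a, lam q * (thetaMod q (a : ZMod q) t - Chebyshev.theta t / q.totient))| ≤ R := by
    intro t ht₁t htx
    have hx₁t : x₁ ≤ t := hx₁.trans ht₁t
    have ht2 : 2 ≤ t := ht₁2.trans ht₁t
    have ht0 : 0 ≤ t := zero_le_two.trans ht2
    -- (1) the `ψ`-piece, by the printed theorem
    have hS1 : |∑ q ∈ moduli Qn a,
        lam q * (LevelOfDistribution.chebyshevPsiMod q (a : ZMod q) t - t / q.totient)| ≤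
        C₁ / (1 - η) ^ (A + 1) * (x / L ^ (A + 1)) := by
      have h := abs_psiSum_le_of_theorem10 (A := A) hε hγ0 hη H10 hx1' hQ1 hQ hlam hx₁t ht₁t
      refine h.trans ((div_log_rpow_le hx1 hη1 ht₁t (by linarith only [hA]) hC₁ ht0).trans ?_)
      rw [← hLdef, mul_div_assoc]
      refine mul_le_mul_of_nonneg_left ?_ (by positivity)
      exact div_le_div_of_nonneg_right htx hLA10.le
    -- (2) the proper prime powers, monotone in `t`, on average over `q ≤ Qn ≤ x^{1 − 3/7}`
    have hS2 : |∑ q ∈ moduli Qn a, lam q * chebyshevPsiModNotPrime q (a : ZMod q) ⌊t⌋₊| ≤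
        1 * (x / L ^ (A + 1)) := by
      have hQn47 : (Qn : ℝ) ≤ x ^ (1 - 3 / 7 : ℝ) := by
        rw [show (1 : ℝ) - 3 / 7 = 4 / 7 by norm_num]; exact hQnle.trans hγ47
      have hfl : ⌊t⌋₊ ≤ ⌊x⌋₊ := Nat.floor_le_floor htx
      calc |∑ q ∈ moduli Qn a, lam q * chebyshevPsiModNotPrime q (a : ZMod q) ⌊t⌋₊|
          ≤ ∑ q ∈ moduli Qn a, |lam q * chebyshevPsiModNotPrime q (a : ZMod q) ⌊t⌋₊| :=
            Finset.abs_sum_le_sum_abs _ _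
        _ ≤ ∑ q ∈ moduli Qn a, ⨆ b : (ZMod q)ˣ, chebyshevPsiModNotPrime q b ⌊x⌋₊ := by
            refine Finset.sum_le_sum fun q hq => ?_
            have hcop : IsCoprime (q : ℤ) a := (Finset.mem_filter.mp hq).2
            obtain ⟨u, hu⟩ := (ZMod.coe_int_isUnit_iff_isCoprime a q).mpr hcop
            rw [abs_mul, abs_of_nonneg (chebyshevPsiModNotPrime_nonneg _ _ _)]
            refine (mul_le_of_le_one_left (chebyshevPsiModNotPrime_nonneg _ _ _) (hlam1 q)).trans ?_
            refine (chebyshevPsiModNotPrime_mono q _ hfl).trans ?_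
            rw [← hu]
            exact chebyshevPsiModNotPrime_le_iSup u _
        _ ≤ ∑ q ∈ Icc 1 Qn, ⨆ b : (ZMod q)ˣ, chebyshevPsiModNotPrime q b ⌊x⌋₊ :=
            Finset.sum_le_sum_of_subset_of_nonneg (moduli_subset Qn a) fun q _ _ =>
              iSup_chebyshevPsiModNotPrime_nonneg q _
        _ ≤ 1 * (x / L ^ (A + 1)) := by rw [one_mul]; exact hPP Qn hQn47
    -- (3) the prime number theorem term
    have hS3 : |(Chebyshev.theta t - t) * ∑ q ∈ moduli Qn a, lam q / q.totient| ≤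
        4 * (C₂' / (1 - η) ^ (A + 3)) * (x / L ^ (A + 1)) := by
      have hθt : |Chebyshev.theta t - t| ≤ C₂' / (1 - η) ^ (A + 3) * x / L ^ (A + 3) := by
        refine (H2 t ht2).trans ?_
        have h1 : C₂ * t / Real.log t ^ (A + 3) ≤ C₂' * t / Real.log t ^ (A + 3) :=
          div_le_div_of_nonneg_right (mul_le_mul_of_nonneg_right (le_max_left _ _) ht0)
            (Real.rpow_pos_of_pos (Real.log_pos (by linarith only [ht2])) _).le
        refine h1.trans ((div_log_rpow_le hx1 hη1 ht₁t (by linarith only [hA]) hC₂'0 ht0).trans ?_)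
        rw [← hLdef]
        exact div_le_div_of_nonneg_right (mul_le_mul_of_nonneg_left htx (by positivity))
          (Real.rpow_pos_of_pos hL0 _).le
      have hS : |∑ q ∈ moduli Qn a, lam q / q.totient| ≤ (1 + Real.log Qn) ^ 2 := by
        refine (Finset.abs_sum_le_sum_abs _ _).trans ?_
        refine le_trans ?_ (Sieve.totientInvSum_le Qn)
        refine le_trans (Finset.sum_le_sum fun q _ => ?_)
          (Finset.sum_le_sum_of_subset_of_nonneg (moduli_subset Qn a) fun q _ _ => by positivity)
        rw [abs_div, Nat.abs_cast, div_eq_mul_inv]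
        exact mul_le_of_le_one_left (by positivity) (hlam1 q)
      rw [abs_mul]
      calc |Chebyshev.theta t - t| * |∑ q ∈ moduli Qn a, lam q / q.totient|
          ≤ (C₂' / (1 - η) ^ (A + 3) * x / L ^ (A + 3)) * (4 * L ^ 2) :=
            mul_le_mul hθt (hS.trans hlogQn2) (abs_nonneg _) (by positivity)
        _ = 4 * (C₂' / (1 - η) ^ (A + 3)) * (x / L ^ (A + 1)) := by
            rw [hLA3]
            field_simp
    -- assemble
    rw [thetaSum_eq]
    have habs : ∀ P S T : ℝ, |P - S - T| ≤ |P| + |S| + |T| := by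
      intro P S T
      have h1 := abs_sub (P - S) T
      have h2 := abs_sub P S
      linarith only [h1, h2]
    refine (habs _ _ _).trans ?_
    have hRsum : R = C₁ / (1 - η) ^ (A + 1) * (x / L ^ (A + 1)) + 1 * (x / L ^ (A + 1)) +
        4 * (C₂' / (1 - η) ^ (A + 3)) * (x / L ^ (A + 1)) := by
      rw [hRdef, hK₁]; ring
    rw [hRsum]
    exact add_le_add (add_le_add hS1 hS2) hS3
  -- the three terms of `B(x) = S_ϑ(x)/L + ∫_2^{t₁} + ∫_{t₁}^x`
  have hT1 :
      |(∑ q ∈ moduli Qn a, lam q * (thetaMod q (a : ZMod q) x - Chebyshev.theta x / q.totient)) / L| ≤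
        K₁ * X := by
    rw [abs_div, abs_of_pos hL0]
    have hKX0 : 0 ≤ K₁ * X := by positivity
    calc |(∑ q ∈ moduli Qn a, lam q * (thetaMod q (a : ZMod q) x - Chebyshev.theta x / q.totient))| / L
        ≤ R / L := div_le_div_of_nonneg_right (hR x ht₁x le_rfl) hL0.le
      _ = K₁ * X / L / L := by rw [hRX]
      _ ≤ K₁ * X / L := div_le_self (by positivity) hL1
      _ ≤ K₁ * X := div_le_self hKX0 hL1
  have hT2 : |∫ t in (2 : ℝ)..t₁,
      (∑ q ∈ moduli Qn a, lam q * (thetaMod q (a : ZMod q) t - Chebyshev.theta t / q.totient)) *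
        (t⁻¹ / Real.log t ^ 2)| ≤
      (20 * D₁ + 2 * D₂) * X := by
    refine (abs_integral_thetaSum_le_small Qn a hlam1 ht₁2).trans ?_
    have e1 : 5 * (1 + Real.log Qn) ^ 2 * t₁ ≤ 20 * D₁ * X := by
      have ht₁0 : 0 ≤ t₁ := zero_le_two.trans ht₁2
      calc 5 * (1 + Real.log Qn) ^ 2 * t₁ ≤ 5 * (4 * L ^ 2) * t₁ := by gcongr
        _ = 20 * (L ^ 2 * x ^ (1 - η)) := by rw [ht₁]; ring
        _ ≤ 20 * (D₁ * X) := by gcongr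
        _ = 20 * D₁ * X := by ring
    have e2 : 2 * (Qn : ℝ) * Real.log t₁ ≤ 2 * D₂ * X := by
      calc 2 * (Qn : ℝ) * Real.log t₁ ≤ 2 * x ^ (4 / 7 : ℝ) * L := by
            gcongr
            exact hQnle.trans hγ47
        _ = 2 * (L * x ^ (4 / 7 : ℝ)) := by ring
        _ ≤ 2 * (D₂ * X) := by gcongr
        _ = 2 * D₂ * X := by ring
    linarith only [e1, e2]
  have hT3 : |∫ t in t₁..x,
      (∑ q ∈ moduli Qn a, lam q * (thetaMod q (a : ZMod q) t - Chebyshev.theta t / q.totient)) *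
        (t⁻¹ / Real.log t ^ 2)| ≤ 2 * K₁ * X := by
    refine (abs_integral_thetaSum_le_large Qn a lam ht₁2 ht₁x hR).trans ?_
    have hKX0 : 0 ≤ K₁ * X := by positivity
    calc R / Real.log t₁ ≤ R / (L / 2) := div_le_div_of_nonneg_left hR0 (by positivity) hlogt₁ge
      _ ≤ 2 * K₁ * X := by
          rw [hRX, div_div, div_le_iff₀ (by positivity)]
          have hLL : 1 ≤ L * (L / 2) * 2 := by nlinarith only [hL1]
          nlinarith only [mul_le_mul_of_nonneg_left hLL hKX0]
  -- assemble `B(x) = S_ϑ(x)/L + ∫_2^{t₁} + ∫_{t₁}^x`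
  have ht₁1 : (1 : ℝ) < t₁ := by linarith only [ht₁2]
  rw [bfiSum_eq_thetaSum Qn a lam hx2, ← intervalIntegral.integral_add_adjacent_intervals (b := t₁)
    (intervalIntegrable_thetaSum_mul Qn a lam one_lt_two ht₁1)
    (intervalIntegrable_thetaSum_mul Qn a lam ht₁1 hx1)]
  have habs : ∀ P I J : ℝ, |P + (I + J)| ≤ |P| + |I| + |J| := by
    intro P I J
    have h1 := abs_add_le P (I + J)
    have h2 := abs_add_le I J
    linarith only [h1, h2]
  refine (habs _ _ _).trans ?_
  have hKX' : K * X = K₁ * X + (20 * D₁ + 2 * D₂) * X + 2 * K₁ * X := by rw [hK]; ring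
  rw [hKX']
  exact add_le_add (add_le_add hT1 hT2) hT3

/-- **BFI Theorem 10 in the `π`-form, from the printed theorem.**  Maynard's restatement
(arXiv:2006.07088, p. 3, "Theorem (Bombieri, Friedlander, Iwaniec)") of Bombieri–Friedlander–Iwaniec,
Acta Math. 156 (1986), Theorem 10, follows from the theorem as printed there (the `ψ`-form,
`BombieriFriedlanderIwaniecTheorem10`), the prime number theorem with the de la Vallée Poussin error
term being PROVED in the tree (`Literature.NumberTheory.LFunctions.ChebyshevThetaDeLaValleePoussin_holds`).
[cite: Maynard2020LargeModuliII, p. 3, Theorem (Bombieri–Friedlander–Iwaniec)] -/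
theorem BombieriFriedlanderIwaniecTheorem10Pi_of_theorem10 (h10 : BombieriFriedlanderIwaniecTheorem10) :
    BombieriFriedlanderIwaniecTheorem10Pi :=
  BombieriFriedlanderIwaniecTheorem10Pi_of_theorem10_of_theta h10
    LFunctions.ChebyshevThetaDeLaValleePoussin_holds

/-! ### The converse: the printed (uniform) `ψ`-form from the `π`-form -/

open BFIReduction in
/-- **BFI Theorem 10 as printed (the `ψ`-form, uniform in `λ`) from the `π`-form.**  The
restatement `BombieriFriedlanderIwaniecTheorem10Pi` (Maynard, arXiv:2006.07088, p. 3) together with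
`ϑ(x) = x + O(x exp(−c√log x))` (`ChebyshevThetaDeLaValleePoussin`) gives back
`BombieriFriedlanderIwaniecTheorem10` (Acta Math. 156 (1986), Theorem 10, as printed).  This is the
argument of `Literature.NumberTheory.Sieve.bfi_wellFactorable_level_of_theorem10Pi`
(`…BombieriFriedlanderIwaniecProofs`, which concludes the family form `bfi_wellFactorable_level`),
run with the constants kept uniform in `λ`: for `x ≥ 2`,
`∑_q λ(q)(ψ(x;q,a) − x/φ(q)) = B(x) log x − ∫_2^x B(t) dt/t + (ϑ(x) − x) ∑_q λ(q)/φ(q)`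
  `+ ∑_q λ(q) PP_q(x)` (`weighted_sum_eq`); the `π`-form with `(A+1, ε/2)` bounds `B(x)` and `B(t)` on `[x^{1−ε/2}, x]`,
the trivial bound `|B(t)| ≤ 2t(1 + log x)² + x^{4/7}` serves below, and the last two terms are
handled by the prime number theorem and the averaged prime-power bound.
[cite: IwaniecKowalski2004, §17.1] -/
theorem BombieriFriedlanderIwaniecTheorem10_of_theorem10Pi_of_theta
    (h10 : BombieriFriedlanderIwaniecTheorem10Pi) (hθ : LFunctions.ChebyshevThetaDeLaValleePoussin) :
    BombieriFriedlanderIwaniecTheorem10 := by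
  intro a ha ε hε A hA
  set γ : ℝ := 4 / 7 - ε with hγ
  rcases lt_or_ge γ 0 with hγ0 | hγ0
  · -- degenerate case `4/7 − ε < 0`: for `x > 1` the moduli range `q ≤ x^γ < 1` is empty
    refine ⟨0, 2, fun x hx _lam _hlam => ?_⟩
    have hx1 : (1 : ℝ) < x := by linarith only [hx]
    have hfloor : ⌊x ^ γ⌋₊ = 0 := Nat.floor_eq_zero.mpr (Real.rpow_lt_one_of_one_lt_of_neg hx1 hγ0)
    rw [hfloor]
    simp
  -- main case `0 ≤ γ = 4/7 − ε`; put `η = ε/2 < 1`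
  set η : ℝ := ε / 2 with hη
  have hη0 : 0 < η := by positivity
  have hη1 : η < 1 := by rw [hη]; linarith only [hγ0, hγ]
  have h1η : 0 < 1 - η := by linarith only [hη1]
  -- the constants
  obtain ⟨C₂, x₂, hC₂, hx₂, H10⟩ :=
    abs_bfiSum_le_of_theorem10Pi h10 ha (by linarith only [hA] : 0 < A + 1) hη0
  obtain ⟨C₃, H3⟩ := hθ.logPow (A + 2)
  obtain ⟨D₁, hD₁, HD1⟩ := exists_log_rpow_mul_rpow_le hA.le (by norm_num : (0:ℝ) ≤ 2) hη0
  obtain ⟨D₂, hD₂, HD2⟩ :=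
    exists_log_rpow_mul_rpow_le hA.le (by norm_num : (0:ℝ) ≤ 1) (by norm_num : (0:ℝ) < 3 / 7)
  set C₃' : ℝ := max C₃ 0 with hC₃'
  have hC₃'0 : 0 ≤ C₃' := le_max_right _ _
  set M₀ : ℝ := C₂ / (1 - η) ^ (A + 1) with hM₀
  have hM₀0 : 0 ≤ M₀ := by positivity
  set K : ℝ := C₂ + (8 * D₁ + D₂ + M₀) + 4 * C₃' + 1 with hK
  -- thresholds in `x`
  have hev₁ : ∀ᶠ x : ℝ in atTop, x₂ ≤ x ^ (1 - η) :=
    (tendsto_rpow_atTop h1η).eventually_ge_atTop x₂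
  obtain ⟨x₀, hx₀⟩ := Filter.eventually_atTop.mp (hev₁.and ((eventually_ge_atTop (Real.exp 1)).and
    (eventually_sum_iSup_chebyshevPsiModNotPrime_le (by norm_num : (0:ℝ) < 3 / 7) A)))
  refine ⟨K, x₀, fun x hx lam hlam => ?_⟩
  obtain ⟨hx₁, hxe, hPP⟩ := hx₀ x hx
  -- basic facts about `x`
  have hx2 : (2 : ℝ) ≤ x := le_trans (by linarith only [Real.add_one_le_exp (1 : ℝ)]) hxe
  have hx1 : (1 : ℝ) < x := by linarith only [hx2]
  have hx1' : (1 : ℝ) ≤ x := hx1.le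
  have hx0 : (0 : ℝ) < x := by linarith only [hx2]
  rw [mul_div_assoc]
  set L : ℝ := Real.log x with hLdef
  have hL1 : 1 ≤ L := by
    rw [hLdef, ← Real.log_exp 1]; exact Real.log_le_log (Real.exp_pos 1) hxe
  have hL0 : 0 < L := by linarith only [hL1]
  have hLA : 0 < L ^ A := Real.rpow_pos_of_pos hL0 A
  set X : ℝ := x / L ^ A with hXdef
  have hX0 : 0 < X := div_pos hx0 hLA
  -- the level and the moduli
  set Qn : ℕ := ⌊x ^ γ⌋₊ with hQn
  have hxγ0 : 0 ≤ x ^ γ := Real.rpow_nonneg hx0.le γ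
  have hQnle : (Qn : ℝ) ≤ x ^ γ := Nat.floor_le hxγ0
  have hγ47 : x ^ γ ≤ x ^ (4 / 7 : ℝ) :=
    Real.rpow_le_rpow_of_exponent_le hx1' (by rw [hγ]; linarith only [hε])
  have hγx : x ^ γ ≤ x := by
    refine (Real.rpow_le_rpow_of_exponent_le hx1'
      (show γ ≤ 1 by rw [hγ]; linarith only [hε])).trans ?_
    rw [Real.rpow_one]
  have hQnx : (Qn : ℝ) ≤ x := hQnle.trans hγx
  have hlogQn0 : 0 ≤ Real.log Qn := Real.log_natCast_nonneg Qn
  have hlogQn : Real.log Qn ≤ L := by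
    rcases Nat.eq_zero_or_pos Qn with h0 | hpos
    · rw [h0, Nat.cast_zero, Real.log_zero]; exact hL0.le
    · exact Real.log_le_log (by exact_mod_cast hpos) hQnx
  have hlogQn2 : (1 + Real.log Qn) ^ 2 ≤ 4 * L ^ 2 := by
    have h : 1 + Real.log Qn ≤ 2 * L := by linarith only [hlogQn, hL1]
    calc (1 + Real.log Qn) ^ 2 ≤ (2 * L) ^ 2 := pow_le_pow_left₀ (by linarith only [hlogQn0]) h 2
      _ = 4 * L ^ 2 := by ring
  -- the weights
  have hlam1 : ∀ q, |lam q| ≤ 1 := fun q => hlam.abs_le_one q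
  -- `t₁ = x^{1-η}`
  set t₁ : ℝ := x ^ (1 - η) with ht₁
  have ht₁2 : 2 ≤ t₁ := hx₂.trans hx₁
  have ht₁x : t₁ ≤ x := by
    refine (Real.rpow_le_rpow_of_exponent_le hx1'
      (show 1 - η ≤ 1 by linarith only [hη0])).trans ?_
    rw [Real.rpow_one]
  have hx₂x : x₂ ≤ x := hx₁.trans ht₁x
  have hlogt₁ : Real.log t₁ = (1 - η) * L := Real.log_rpow hx0 _
  have hlogt₁L : Real.log t₁ ≤ L := by
    rw [hlogt₁]; exact mul_le_of_le_one_left hL0.le (by linarith only [hη0])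
  have hlogt₁0 : 0 ≤ Real.log t₁ := Real.log_nonneg (by linarith only [ht₁2])
  -- power bookkeeping
  have hLA1 : L ^ (A + 1) = L ^ A * L := Real.rpow_add_one hL0.ne' A
  have hLA2 : L ^ (A + 2) = L ^ A * L ^ 2 := by
    rw [Real.rpow_add hL0, Real.rpow_two]
  have HD1x : L ^ 2 * x ^ (1 - η) ≤ D₁ * X := by
    have := HD1 x hx1; rwa [Real.rpow_two] at this
  have HD2x : L * x ^ (4 / 7 : ℝ) ≤ D₂ * X := by
    have := HD2 x hx1; rwa [Real.rpow_one, show (1 : ℝ) - 3 / 7 = 4 / 7 by norm_num] at this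
  -- (T1) the boundary term `B(x) log x`
  have hT1 : |bfiSum Qn a lam x * L| ≤ C₂ * X := by
    have hQ : x ^ γ ≤ x ^ (4 / 7 - η) :=
      Real.rpow_le_rpow_of_exponent_le hx1' (by rw [hγ, hη]; linarith only [hε])
    have h := H10 x hx₂x (x ^ γ) hQ lam hlam
    rw [abs_mul, abs_of_pos hL0]
    calc |bfiSum Qn a lam x| * L ≤ C₂ * x / L ^ (A + 1) * L :=
          mul_le_mul_of_nonneg_right h hL0.le
      _ = C₂ * X := by rw [hLA1, hXdef]; field_simp
  -- (T2) the integral term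
  have hT2 : |∫ t in (2 : ℝ)..x, bfiSum Qn a lam t / t| ≤ (8 * D₁ + D₂ + M₀) * X := by
    set M : ℝ := M₀ / L ^ (A + 1) with hM
    have hM0 : 0 ≤ M := by positivity
    have hB : ∀ t, t₁ ≤ t → t ≤ x → |bfiSum Qn a lam t| ≤ M * t := by
      intro t ht₁t htx
      have hx₂t : x₂ ≤ t := hx₁.trans ht₁t
      have ht0 : 0 ≤ t := zero_le_two.trans (ht₁2.trans ht₁t)
      have hQ : x ^ γ ≤ t ^ (4 / 7 - η) := rpow_level_le_rpow hε hγ0 hx1' ht₁t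
      have h := H10 t hx₂t (x ^ γ) hQ lam hlam
      refine h.trans ((div_log_rpow_le hx1 hη1 ht₁t (by linarith only [hA]) hC₂ ht0).trans
        (le_of_eq ?_))
      rw [hM, hM₀, ← hLdef]
      field_simp
    have h := abs_integral_bfiSum_div_le Qn a hlam1 ht₁2 ht₁x hM0 hB
    refine h.trans ?_
    have e1 : 2 * (1 + Real.log Qn) ^ 2 * t₁ ≤ 8 * D₁ * X := by
      have ht₁0 : 0 ≤ t₁ := zero_le_two.trans ht₁2
      calc 2 * (1 + Real.log Qn) ^ 2 * t₁ ≤ 2 * (4 * L ^ 2) * t₁ := by gcongr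
        _ = 8 * (L ^ 2 * x ^ (1 - η)) := by rw [ht₁]; ring
        _ ≤ 8 * (D₁ * X) := by gcongr
        _ = 8 * D₁ * X := by ring
    have e2 : (Qn : ℝ) * Real.log t₁ ≤ D₂ * X := by
      calc (Qn : ℝ) * Real.log t₁ ≤ x ^ (4 / 7 : ℝ) * L :=
            mul_le_mul (hQnle.trans hγ47) hlogt₁L hlogt₁0 (Real.rpow_nonneg hx0.le _)
        _ = L * x ^ (4 / 7 : ℝ) := mul_comm _ _
        _ ≤ D₂ * X := HD2x
    have e3 : M * x ≤ M₀ * X := by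
      rw [hM, hLA1, hXdef]
      rw [div_mul_eq_mul_div, div_le_iff₀ (by positivity)]
      calc M₀ * x = M₀ * (x / L ^ A) * (L ^ A * 1) := by field_simp
        _ ≤ M₀ * (x / L ^ A) * (L ^ A * L) := by gcongr
    linarith only [e1, e2, e3]
  -- (T3) the prime number theorem term
  have hT3 : |(Chebyshev.theta x - x) * ∑ q ∈ moduli Qn a, lam q / q.totient| ≤ 4 * C₃' * X := by
    have hθx : |Chebyshev.theta x - x| ≤ C₃' * x / L ^ (A + 2) := by
      refine (H3 x hx2).trans ?_
      exact div_le_div_of_nonneg_right (mul_le_mul_of_nonneg_right (le_max_left _ _) hx0.le)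
        (Real.rpow_pos_of_pos hL0 _).le
    have hS : |∑ q ∈ moduli Qn a, lam q / q.totient| ≤ (1 + Real.log Qn) ^ 2 := by
      refine (Finset.abs_sum_le_sum_abs _ _).trans ?_
      refine le_trans ?_ (Sieve.totientInvSum_le Qn)
      refine le_trans (Finset.sum_le_sum fun q _ => ?_)
        (Finset.sum_le_sum_of_subset_of_nonneg (moduli_subset Qn a) fun q _ _ => by positivity)
      rw [abs_div, Nat.abs_cast, div_eq_mul_inv]
      exact mul_le_of_le_one_left (by positivity) (hlam1 q)
    rw [abs_mul]
    calc |Chebyshev.theta x - x| * |∑ q ∈ moduli Qn a, lam q / q.totient|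
        ≤ (C₃' * x / L ^ (A + 2)) * (4 * L ^ 2) :=
          mul_le_mul hθx (hS.trans hlogQn2) (abs_nonneg _) (by positivity)
      _ = 4 * C₃' * X := by rw [hLA2, hXdef]; field_simp
  -- (T4) the proper prime powers, on average over `q ≤ Qn ≤ x^{4/7} = x^{1 − 3/7}` (tree input)
  have hT4 : |∑ q ∈ moduli Qn a, lam q * chebyshevPsiModNotPrime q (a : ZMod q) ⌊x⌋₊| ≤ 1 * X := by
    have hQn47 : (Qn : ℝ) ≤ x ^ (1 - 3 / 7 : ℝ) := by
      rw [show (1 : ℝ) - 3 / 7 = 4 / 7 by norm_num]; exact hQnle.trans hγ47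
    calc |∑ q ∈ moduli Qn a, lam q * chebyshevPsiModNotPrime q (a : ZMod q) ⌊x⌋₊|
        ≤ ∑ q ∈ moduli Qn a, |lam q * chebyshevPsiModNotPrime q (a : ZMod q) ⌊x⌋₊| :=
          Finset.abs_sum_le_sum_abs _ _
      _ ≤ ∑ q ∈ moduli Qn a, ⨆ b : (ZMod q)ˣ, chebyshevPsiModNotPrime q b ⌊x⌋₊ := by
          refine Finset.sum_le_sum fun q hq => ?_
          have hcop : IsCoprime (q : ℤ) a := (Finset.mem_filter.mp hq).2
          obtain ⟨u, hu⟩ := (ZMod.coe_int_isUnit_iff_isCoprime a q).mpr hcop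
          rw [abs_mul, abs_of_nonneg (chebyshevPsiModNotPrime_nonneg _ _ _)]
          refine (mul_le_of_le_one_left (chebyshevPsiModNotPrime_nonneg _ _ _) (hlam1 q)).trans ?_
          rw [← hu]
          exact chebyshevPsiModNotPrime_le_iSup u _
      _ ≤ ∑ q ∈ Icc 1 Qn, ⨆ b : (ZMod q)ˣ, chebyshevPsiModNotPrime q b ⌊x⌋₊ :=
          Finset.sum_le_sum_of_subset_of_nonneg (moduli_subset Qn a) fun q _ _ =>
            iSup_chebyshevPsiModNotPrime_nonneg q _
      _ ≤ 1 * X := by rw [one_mul]; exact hPP Qn hQn47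
  -- assemble
  have hsum : (∑ q ∈ (Icc 1 ⌊x ^ γ⌋₊).filter (fun q : ℕ => IsCoprime (q : ℤ) a),
      lam q * (LevelOfDistribution.chebyshevPsiMod q (a : ZMod q) x - x / Nat.totient q)) =
      ∑ q ∈ moduli Qn a,
        lam q * (LevelOfDistribution.chebyshevPsiMod q (a : ZMod q) x - x / q.totient) := rfl
  rw [hsum, weighted_sum_eq Qn a lam hx2]
  have habs : ∀ P I T S : ℝ, |P - I + T + S| ≤ |P| + |I| + |T| + |S| := by
    intro P I T S
    have h1 := abs_add_le (P - I + T) S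
    have h2 := abs_add_le (P - I) T
    have h3 := abs_sub P I
    linarith only [h1, h2, h3]
  refine (habs _ _ _ _).trans ?_
  have hKX : K * X = C₂ * X + (8 * D₁ + D₂ + M₀) * X + 4 * C₃' * X + 1 * X := by
    rw [hK]; ring
  rw [hKX]
  exact add_le_add (add_le_add (add_le_add hT1 hT2) hT3) hT4

/-- **The two vendored forms of BFI Theorem 10 are equivalent** (given the prime number theorem
with the de la Vallée Poussin error term, which is proved in the tree): the `π`-form as restated by
Maynard (arXiv:2006.07088, p. 3) and Lichtman (arXiv:2309.08522, (1.3)) holds iff the `ψ`-form as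
printed in Bombieri–Friedlander–Iwaniec, Acta Math. 156 (1986), Theorem 10, holds — the standard
partial-summation equivalence (Iwaniec–Kowalski §17.1), here with the uniformity in the
well-factorable weight `λ` (and, for the `π`-form, in the level `Q ≤ x^{4/7−ε}`) carried through.
[cite: IwaniecKowalski2004, §17.1] -/
theorem BombieriFriedlanderIwaniecTheorem10Pi_iff_theorem10 :
    BombieriFriedlanderIwaniecTheorem10Pi ↔ BombieriFriedlanderIwaniecTheorem10 :=
  ⟨fun h => BombieriFriedlanderIwaniecTheorem10_of_theorem10Pi_of_theta h
      LFunctions.ChebyshevThetaDeLaValleePoussin_holds,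
    fun h => BombieriFriedlanderIwaniecTheorem10Pi_of_theorem10 h⟩

end Literature.NumberTheory.Sieve
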